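import Summits.AtomisticToContinuum.BoseEinsteinCondensation.Theorems.BECGroundStateSOSPeriodicIRBoundTwoSectorLowDefs
import HarnessLib

/-!
# Route `BECGroundStateSOS`, crux `PeriodicIRBound` (stmt-AtomisticToContinuum-3972), line `two-sector-gd-transfer` (v9) —
# stub S9a `stub_channelsOfSectorGaps : ChannelsOfSectorGaps` (channels from sector gaps at fixed `(N, L)`)

Supports (does not close) stmt-AtomisticToContinuum-3972. The registered stub S9a of the v9 skeleton (statement
`ChannelsOfSectorGaps` in `Theorems/BECGroundStateSOSPeriodicIRBoundTwoSectorLowDefs.lean` §2): at fixed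
`(N, L) = (m+2, L)`, a mode `n` with `p = 2πn/L`, a bound `b > 0`, an a-priori occupation bound `n_k(Ψ) ≤ B` on the
momentum-zero `δ₁`-near-minimisers, and a real `μ` with the two SECTOR GAPS `E₀ + μ + (B+1)/b ≤ E₊ := E_{N+1}(p)` and
`E₀ − μ + B/b ≤ E₋ := E_{N−1}(p)` (read in `ℝ`), the momentum-zero particle channel `ChanPlusZero` holds against
`E₀ + μ` and the hole channel `ChanMinusZero` against `E₀ − μ`, both with bound `b`.

Proof (the sector variational principle on the exact-momentum test vectors). Take the slack `δ := min δ₁ 1`, so that a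
`δ`-near-minimiser `Ψ` (normalised, `‖ψ‖² = 1`) has finite energy `𝓔[ψ] ≤ E₀ + 1 < ⊤`. Particle channel: `a†(φ_n)ψ` is a
core function (`WF.isCore_modeCr`) of total momentum `p` (`WF.hasTotalMomentum_modeCr`), of mass `‖a†ψ‖² = 1 + n_k`
(`WF.normSq_modeCr`) and finite energy (`WF.qform_modeCr_le`), so `E₊·(n_k + 1) ≤ 𝓔[a†ψ]`
(`WF.momentumSectorEnergy_mul_normSq_le`); with the gap and `0 ≤ n_k ≤ B`,
`𝓔[a†ψ] − (E₀+μ)(n_k+1) ≥ ((B+1)/b)(n_k+1) ≥ (n_k+1)²/b ≥ 0`, whence the `η`-regularised inequality. Hole channel: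
`a(φ_n)ψ` is a core function (`WF.isCore_modeAn`) of total momentum `−p` (`WF.hasTotalMomentum_modeAn`), mass `n_k`
(`WF.normSq_modeAn`), finite energy (`WF.qform_modeAn_le`), and `E_{N−1}(−p) = E_{N−1}(p)` (`momentumSectorEnergy_neg`), so
`E₋·n_k ≤ 𝓔[aψ]` and `𝓔[aψ] − (E₀−μ)n_k ≥ (B/b)n_k ≥ n_k²/b ≥ 0`. The finiteness hypotheses on `E₊`, `E₋` and `n ≠ 0`,
`0 ≤ B` of the registered statement are not needed (a `⊤` sector energy reads as `0` in `ℝ` and makes the gap, hence the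
channel, only easier). No open mathematics. References (shape only; nothing is cited as a fact): T. Kennedy, E. H. Lieb,
B. S. Shastry, J. Stat. Phys. 53 (1988) 1019, (12); H. D. Cornean, J. Dereziński, P. Ziń, J. Math. Phys. 50 (2009)
062103, §1.1.
-/

noncomputable section

open scoped BigOperators ENNReal ComplexConjugate
open Filter MeasureTheory

namespace Summit.AtomisticToContinuum.BoseEinsteinCondensation.Cruxes.PeriodicIRBound.TwoSectorGdTransfer

open Literature.MathematicalPhysics.QuantumManyBody.BoseGas
open Summit.AtomisticToContinuum.BoseEinsteinCondensation.Cruxes.PeriodicIRBound.LinearPhFloorWagner.WF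

namespace SectorGaps

/-! ### Real-arithmetic cores of the two channels -/

/-- **Particle-channel arithmetic**: from `0 ≤ nk ≤ B`, the gap `e0 + μ + (B+1)/b ≤ eP` and the sector bound
`eP·(nk+1) ≤ qC` one gets `(nk+1)² ≤ b·((1+η)(qC − (e0+μ)(nk+1)) + η(nk+1))` for `b, η > 0`. -/
theorem real_core_plus {b B μ e0 eP nk qC η : ℝ} (hb : 0 < b) (hη : 0 < η) (hnk0 : 0 ≤ nk) (hnkB : nk ≤ B)
    (hgap : e0 + μ + (B + 1) / b ≤ eP) (hq : eP * (nk + 1) ≤ qC) :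
    (nk + 1) ^ 2 ≤ b * ((1 + η) * (qC - (e0 + μ) * (nk + 1)) + η * (nk + 1)) := by
  have hnk1 : 0 ≤ nk + 1 := by linarith
  have hS : (nk + 1) / b * (nk + 1) ≤ qC - (e0 + μ) * (nk + 1) := by
    have h1 : (nk + 1) / b ≤ (B + 1) / b := div_le_div_of_nonneg_right (by linarith) hb.le
    have h2 : (B + 1) / b ≤ eP - (e0 + μ) := by linarith
    have h3 := mul_le_mul_of_nonneg_right (h1.trans h2) hnk1
    linarith
  have hsq : (nk + 1) ^ 2 = b * ((nk + 1) / b * (nk + 1)) := by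
    field_simp
  have hS0 : 0 ≤ qC - (e0 + μ) * (nk + 1) := le_trans (by positivity) hS
  calc (nk + 1) ^ 2 = b * ((nk + 1) / b * (nk + 1)) := hsq
    _ ≤ b * (qC - (e0 + μ) * (nk + 1)) := mul_le_mul_of_nonneg_left hS hb.le
    _ ≤ b * ((1 + η) * (qC - (e0 + μ) * (nk + 1)) + η * (nk + 1)) := by
        refine mul_le_mul_of_nonneg_left ?_ hb.le
        nlinarith [mul_nonneg hη.le hS0, mul_nonneg hη.le hnk1]

/-- **Hole-channel arithmetic**: from `0 ≤ nk ≤ B`, the gap `e0 − μ + B/b ≤ eM` and the sector bound `eM·nk ≤ qA`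
one gets `nk² ≤ b·((1+η)(qA − (e0−μ)nk) + η·nk)` for `b, η > 0`. -/
theorem real_core_minus {b B μ e0 eM nk qA η : ℝ} (hb : 0 < b) (hη : 0 < η) (hnk0 : 0 ≤ nk) (hnkB : nk ≤ B)
    (hgap : e0 - μ + B / b ≤ eM) (hq : eM * nk ≤ qA) :
    nk ^ 2 ≤ b * ((1 + η) * (qA - (e0 - μ) * nk) + η * nk) := by
  have hS : nk / b * nk ≤ qA - (e0 - μ) * nk := by
    have h1 : nk / b ≤ B / b := div_le_div_of_nonneg_right hnkB hb.le
    have h2 : B / b ≤ eM - (e0 - μ) := by linarith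
    have h3 := mul_le_mul_of_nonneg_right (h1.trans h2) hnk0
    linarith
  have hsq : nk ^ 2 = b * (nk / b * nk) := by
    field_simp
  have hS0 : 0 ≤ qA - (e0 - μ) * nk := le_trans (by positivity) hS
  calc nk ^ 2 = b * (nk / b * nk) := hsq
    _ ≤ b * (qA - (e0 - μ) * nk) := mul_le_mul_of_nonneg_left hS hb.le
    _ ≤ b * ((1 + η) * (qA - (e0 - μ) * nk) + η * nk) := by
        refine mul_le_mul_of_nonneg_left ?_ hb.le
        nlinarith [mul_nonneg hη.le hS0, mul_nonneg hη.le hnk0]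

/-! ### Small conversions (`(k+1 : ℝ≥0∞) ≠ ⊤` is the landed `PooledFloat.natCast_add_one_ne_top` of `…TwoSectorPooledToFloating.lean`) -/

/-- A `min δ₁ 1`-near-minimiser of `H_{m+2}` with `E₀(m+2) < ⊤` has finite energy form. -/
theorem qform_ne_top_of_nearMinAt {v : ℝ → ℝ≥0∞} {m : ℕ} {L : ℝ} {δ₁ : ℝ≥0∞}
    (hE0 : periodicGroundStateEnergy v (m + 2) L ≠ ⊤) (Ψ : PeriodicTrialState (m + 2) L)
    (hΨ : NearMinAt v (min δ₁ 1) Ψ) : qform v L Ψ.ψ ≠ ⊤ := by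
  have hδtop : min δ₁ 1 ≠ ⊤ := ne_top_of_le_ne_top ENNReal.one_ne_top (min_le_right _ _)
  have hψE : qform v L Ψ.ψ ≤ periodicGroundStateEnergy v (m + 2) L + min δ₁ 1 := hΨ
  exact ne_top_of_le_ne_top (ENNReal.add_ne_top.2 ⟨hE0, hδtop⟩) hψE

/-- The occupation `n_k(ψ)` of a normalised trial state is finite (`n_k ≤ N‖ψ‖² = N`). -/
theorem cellOccupation_trialState_ne_top {m : ℕ} {L : ℝ} (hL : 0 < L) (n : Fin 3 → ℤ)
    (Ψ : PeriodicTrialState (m + 2) L) : cellOccupation (m + 2) L (planeWaveMode L n) Ψ.ψ ≠ ⊤ := by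
  have hψ1 : normSq L Ψ.ψ = 1 := Ψ.norm_eq
  have hνle : cellOccupation (m + 2) L (planeWaveMode L n) Ψ.ψ ≤ ((m + 2 : ℕ) : ℝ≥0∞) * normSq L Ψ.ψ :=
    cellOccupation_le_mul_normSq hL n (isCore_trialState Ψ).contDiff.continuous
  rw [hψ1, mul_one] at hνle
  exact ne_top_of_le_ne_top (ENNReal.natCast_ne_top _) hνle

/-! ### The two channels from the two sector gaps -/

/-- **Particle channel from the particle-sector gap**: with an occupation bound `n_k ≤ B` on momentum-zero
`δ₁`-near-minimisers, `E₀ < ⊤` and the real gap `E₀ + μ + (B+1)/b ≤ E_{N+1}(2πn/L)`, the momentum-zero particle channel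
`ChanPlusZero v m L n (E₀ + μ) b` holds (slack `min δ₁ 1` for every `η`). -/
theorem chanPlusZero_of_gap (v : ℝ → ℝ≥0∞) (hv : IsRepulsiveFiniteRange v) (hint : (∫⁻ x : Space, v ‖x‖) ≠ ⊤)
    {m : ℕ} {L : ℝ} (hL : 0 < L) (n : Fin 3 → ℤ) {b B μ : ℝ} {δ₁ : ℝ≥0∞} (hb : 0 < b) (hδ₁ : 0 < δ₁)
    (hocc : ∀ Ψ : PeriodicTrialState (m + 2) L, NearMinAt v δ₁ Ψ → HasTotalMomentum 0 Ψ.ψ →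
      (cellOccupation (m + 2) L (planeWaveMode L n) Ψ.ψ).toReal ≤ B)
    (hE0 : periodicGroundStateEnergy v (m + 2) L ≠ ⊤)
    (gapP : (periodicGroundStateEnergy v (m + 2) L).toReal + μ + (B + 1) / b ≤
      (momentumSectorEnergy v (m + 2 + 1) L (latticeVec (2 * Real.pi / L) n)).toReal) :
    ChanPlusZero v m L n ((periodicGroundStateEnergy v (m + 2) L).toReal + μ) b := by
  intro η hη
  refine ⟨min δ₁ 1, lt_min hδ₁ one_pos, fun Ψ hΨ h0 => ?_⟩
  have hΨ₁ : NearMinAt v δ₁ Ψ := le_trans hΨ (add_le_add le_rfl (min_le_left _ _))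
  have hnkB := hocc Ψ hΨ₁ h0
  simp only
  -- the state and the particle test vector `a†(φ_n)ψ`
  set ψ : Config (m + 2) → ℂ := Ψ.ψ with hψdef
  have hψc : IsCore L ψ := isCore_trialState Ψ
  have hψ1 : normSq L ψ = 1 := Ψ.norm_eq
  have hψEtop : qform v L ψ ≠ ⊤ := qform_ne_top_of_nearMinAt hE0 Ψ hΨ
  have hnψtop : normSq L ψ ≠ ⊤ := by rw [hψ1]; exact ENNReal.one_ne_top
  set cΨ : Config (m + 2 + 1) → ℂ := modeCr (planeWaveMode L n) ψ with hcΨ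
  have hcΨc : IsCore L cΨ := isCore_modeCr hL n hψc
  have hcΨm : HasTotalMomentum (latticeVec (2 * Real.pi / L) n) cΨ := hasTotalMomentum_modeCr n h0
  -- mass `‖a†ψ‖² = 1 + n_k`
  set νE : ℝ≥0∞ := cellOccupation (m + 2) L (planeWaveMode L n) ψ with hνE
  have hνtop : νE ≠ ⊤ := cellOccupation_trialState_ne_top hL n Ψ
  have hmass : normSq L cΨ = 1 + νE := by rw [hcΨ, normSq_modeCr hL n hψc, hψ1]
  -- finite energy of `a†ψ`
  have hcΨE := qform_modeCr_le hL hv.1 hint n hψc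
  have hcΨEtop : qform v L cΨ ≠ ⊤ :=
    ne_top_of_le_ne_top (ENNReal.mul_ne_top (PooledFloat.natCast_add_one_ne_top _) (ENNReal.add_ne_top.2
      ⟨hψEtop, ENNReal.mul_ne_top ENNReal.ofReal_ne_top hnψtop⟩)) hcΨE
  -- the sector variational principle in the sector `p = 2πn/L` of `N + 1` bodies
  have hA2 : momentumSectorEnergy v (m + 2 + 1) L (latticeVec (2 * Real.pi / L) n) * (1 + νE) ≤ qform v L cΨ := by
    rw [← hmass]
    exact momentumSectorEnergy_mul_normSq_le hL v hcΨc hcΨm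
  -- to the reals
  set nk : ℝ := νE.toReal with hnk
  have hnk0 : 0 ≤ nk := ENNReal.toReal_nonneg
  have hq : (momentumSectorEnergy v (m + 2 + 1) L (latticeVec (2 * Real.pi / L) n)).toReal * (nk + 1) ≤
      (qform v L cΨ).toReal := by
    have h := ENNReal.toReal_mono hcΨEtop hA2
    rw [ENNReal.toReal_mul, ENNReal.toReal_add ENNReal.one_ne_top hνtop, ENNReal.toReal_one] at h
    linarith
  exact real_core_plus hb hη hnk0 hnkB gapP hq

/-- **Hole channel from the hole-sector gap**: with an occupation bound `n_k ≤ B` on momentum-zero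
`δ₁`-near-minimisers, `E₀ < ⊤` and the real gap `E₀ − μ + B/b ≤ E_{N−1}(2πn/L)`, the momentum-zero hole channel
`ChanMinusZero v m L n (E₀ − μ) b` holds (slack `min δ₁ 1` for every `η`; `E_{N−1}(−p) = E_{N−1}(p)`). -/
theorem chanMinusZero_of_gap (v : ℝ → ℝ≥0∞) (hv : IsRepulsiveFiniteRange v) {m : ℕ} {L : ℝ} (hL : 0 < L)
    (n : Fin 3 → ℤ) {b B μ : ℝ} {δ₁ : ℝ≥0∞} (hb : 0 < b) (hδ₁ : 0 < δ₁)
    (hocc : ∀ Ψ : PeriodicTrialState (m + 2) L, NearMinAt v δ₁ Ψ → HasTotalMomentum 0 Ψ.ψ →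
      (cellOccupation (m + 2) L (planeWaveMode L n) Ψ.ψ).toReal ≤ B)
    (hE0 : periodicGroundStateEnergy v (m + 2) L ≠ ⊤)
    (gapM : (periodicGroundStateEnergy v (m + 2) L).toReal - μ + B / b ≤
      (momentumSectorEnergy v (m + 1) L (latticeVec (2 * Real.pi / L) n)).toReal) :
    ChanMinusZero v m L n ((periodicGroundStateEnergy v (m + 2) L).toReal - μ) b := by
  intro η hη
  refine ⟨min δ₁ 1, lt_min hδ₁ one_pos, fun Ψ hΨ h0 => ?_⟩
  have hΨ₁ : NearMinAt v δ₁ Ψ := le_trans hΨ (add_le_add le_rfl (min_le_left _ _))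
  have hnkB := hocc Ψ hΨ₁ h0
  simp only
  -- the state and the hole test vector `a(φ_n)ψ`
  set ψ : Config (m + 2) → ℂ := Ψ.ψ with hψdef
  have hψc : IsCore L ψ := isCore_trialState Ψ
  have hψEtop : qform v L ψ ≠ ⊤ := qform_ne_top_of_nearMinAt hE0 Ψ hΨ
  set aΨ : Config (m + 1) → ℂ := modeAn L (planeWaveMode L n) ψ with haΨ
  have haΨc : IsCore L aΨ := isCore_modeAn hL n hψc
  have haΨm : HasTotalMomentum (-latticeVec (2 * Real.pi / L) n) aΨ := hasTotalMomentum_modeAn hL n hψc h0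
  -- mass `‖aψ‖² = n_k`
  set νE : ℝ≥0∞ := cellOccupation (m + 2) L (planeWaveMode L n) ψ with hνE
  have hmass : normSq L aΨ = νE := normSq_modeAn hL n ψ
  -- finite energy of `aψ`
  have haΨE := qform_modeAn_le hL hv.1 n hψc
  have haΨEtop : qform v L aΨ ≠ ⊤ :=
    ne_top_of_le_ne_top (ENNReal.mul_ne_top (PooledFloat.natCast_add_one_ne_top _) hψEtop) haΨE
  -- the sector variational principle in the sector `-p` of `N - 1` bodies, and `E(-p) = E(p)`
  have hA2 : momentumSectorEnergy v (m + 1) L (latticeVec (2 * Real.pi / L) n) * νE ≤ qform v L aΨ := by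
    rw [← momentumSectorEnergy_neg, ← hmass]
    exact momentumSectorEnergy_mul_normSq_le hL v haΨc haΨm
  -- to the reals
  set nk : ℝ := νE.toReal with hnk
  have hnk0 : 0 ≤ nk := ENNReal.toReal_nonneg
  have hq : (momentumSectorEnergy v (m + 1) L (latticeVec (2 * Real.pi / L) n)).toReal * nk ≤
      (qform v L aΨ).toReal := by
    have h := ENNReal.toReal_mono haΨEtop hA2
    rwa [ENNReal.toReal_mul] at h
  exact real_core_minus hb hη hnk0 hnkB gapM hq

end SectorGaps

/-- **Stub S9a of the line `two-sector-gd-transfer` (v9)**: channels from sector gaps at fixed `(N, L)` — the two real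
sector gaps against `E₀(N) ± μ` give the two momentum-zero channel inequalities `ChanPlusZero` / `ChanMinusZero` with the
same bound `b` (the sector variational principle on the exact-momentum test vectors `a†(φ_n)ψ`, `a(φ_n)ψ`). -/
theorem stub_channelsOfSectorGaps : ChannelsOfSectorGaps := by
  intro v hv hint m L hL n _hn b B μ δ₁ hb _hB hδ₁ hocc hE0 _hEP _hEM gapP gapM
  exact ⟨SectorGaps.chanPlusZero_of_gap v hv hint hL n hb hδ₁ hocc hE0 gapP,
    SectorGaps.chanMinusZero_of_gap v hv hL n hb hδ₁ hocc hE0 gapM⟩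

end Summit.AtomisticToContinuum.BoseEinsteinCondensation.Cruxes.PeriodicIRBound.TwoSectorGdTransfer

end
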